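import Mathlib
import Literature.MathematicalPhysics.StatisticalMechanics.Crystallization
import Literature.MathematicalPhysics.StatisticalMechanics.PeriodicConfigurationSums

/-!
# Crux `ExactCertificate` (stmt-AtomisticToContinuum-11959), line `closure-makes-nogap-exact`,
# Transfer skeleton VI (`UniquePeriodicMinimiser1D`): stub `stub_block1D`

Support file for the crux `ThreeConeCertificate.ExactCertificate`, d = 1 transfer skeleton VI
(`Cruxes.ExactCertificate.Transfer1D.UniquePeriodicMinimiser1D`).  This file proves the
registered stub `stub_block1D`, the BLOCK BOOKKEEPING of a periodic configuration
`Q = F + ℤv` of the line (`F = Q.motif`, `Q.lattice = ℤv`, hypothesis `hv`): the block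
configuration of `K` cells is the family of `#F · K` points

  `i ↦ y(i) + j(i) • v`,   `(y(i), j(i)) = (F.equivFin⁻¹ × id)(finProdFinEquiv⁻¹ i) ∈ F × Fin K`,

and

* (1) it is injective (`y + jv = y' + j'v ⇒ y - y' ∈ ℤv ⇒ y = y'` by `eq_of_sub_mem`, then
  `j = j'` since `v ≠ 0`, the lattice having rank one: `PeriodicConfiguration.finrank_lattice`);
* (2) it lies in `Q.points` (`add_mem_points`);
* (3) DEEP COUNT: for every radius `R` there is a depth `D = 2 D₀`, `D₀ = ⌈(R + 2B)/‖v‖⌉₊ + 1`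
  with `B = Σ_{y ∈ F} ‖y‖`, such that for every site `q₀ ∈ Q.points` (motif representative
  `y₀`, `q₀ - y₀ ∈ ℤv`) the `K - 2 D₀` block points `y₀ + jv`, `D₀ ≤ j < K - D₀`, are congruent
  to `q₀` modulo the lattice and `R`-deep: a point `z = y' + m v ∈ Q.points` with
  `dist z (y₀ + jv) ≤ R` has `|m - j| · ‖v‖ ≤ R + ‖y'‖ + ‖y₀‖ ≤ R + 2B`, so `|m - j| < D₀`,
  `0 ≤ m < K`, and `z` is the block point `(y', m)`; the bound
  `(K : ℝ) - D ≤ Nat.card {deep congruent indices}` follows from the explicit injection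
  `Fin (K - 2D₀) → {…}`, `t ↦ finProdFinEquiv (F.equivFin y₀, t + D₀)`.

Elementary (`Nat.card_le_card_of_injective`, `finProdFinEquiv`, `norm_smul`, `Nat.le_ceil`);
helper lemmas prefixed `ublock_`.  All `[folklore]`; no named facts are used.
-/

noncomputable section

namespace Summit.AtomisticToContinuum.Crystallization.Theorems.ThreeConeCertificateExactCertificate.Transfer1D

open Literature.MathematicalPhysics.StatisticalMechanics MeasureTheory Set Filter Topology
open scoped BigOperators

/-- A generator `v` of the lattice of periods `Q.lattice = ℤv` of a periodic configuration of
the line is non-zero: the lattice has rank one (`PeriodicConfiguration.finrank_lattice`), hence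
a non-zero element `n • v`. [folklore] -/
theorem ublock_v_ne_zero (Q : PeriodicConfiguration 1) {v : EuclideanSpace ℝ (Fin 1)}
    (hv : ∀ g : EuclideanSpace ℝ (Fin 1), g ∈ Q.lattice ↔ ∃ n : ℤ, g = n • v) : v ≠ 0 := by
  haveI : Nontrivial Q.lattice :=
    Module.nontrivial_of_finrank_eq_succ (R := ℤ) (n := 0) Q.finrank_lattice
  obtain ⟨g, hg⟩ := exists_ne (0 : Q.lattice)
  obtain ⟨n, hn⟩ := (hv g.1).1 g.2
  rintro rfl
  exact hg ((Submodule.coe_eq_zero).1 (hn.trans (smul_zero n)))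

/-- Real multiples `(m : ℝ) • v`, `m ∈ ℤ`, of the generator are lattice vectors. [folklore] -/
theorem ublock_intCast_smul_mem (Q : PeriodicConfiguration 1) {v : EuclideanSpace ℝ (Fin 1)}
    (hv : ∀ g : EuclideanSpace ℝ (Fin 1), g ∈ Q.lattice ↔ ∃ n : ℤ, g = n • v) (m : ℤ) :
    (m : ℝ) • v ∈ Q.lattice :=
  (hv _).2 ⟨m, Int.cast_smul_eq_zsmul ℝ m v⟩

/-- Real multiples `(k : ℝ) • v`, `k ∈ ℕ`, of the generator are lattice vectors. [folklore] -/
theorem ublock_natCast_smul_mem (Q : PeriodicConfiguration 1) {v : EuclideanSpace ℝ (Fin 1)}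
    (hv : ∀ g : EuclideanSpace ℝ (Fin 1), g ∈ Q.lattice ↔ ∃ n : ℤ, g = n • v) (k : ℕ) :
    (k : ℝ) • v ∈ Q.lattice := by
  simpa only [Int.cast_natCast] using ublock_intCast_smul_mem Q hv (k : ℤ)

/-- Block coordinates are unique: for motif points `y, y'` and `j, j' ∈ ℕ`,
`y + j • v = y' + j' • v` forces `y = y'` (`y - y' = (j' - j) • v ∈ ℤv`, `eq_of_sub_mem`) and
then `j = j'` (`v ≠ 0`). [folklore] -/
theorem ublock_coord_eq (Q : PeriodicConfiguration 1) {v : EuclideanSpace ℝ (Fin 1)}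
    (hv : ∀ g : EuclideanSpace ℝ (Fin 1), g ∈ Q.lattice ↔ ∃ n : ℤ, g = n • v)
    {y y' : EuclideanSpace ℝ (Fin 1)} (hy : y ∈ Q.motif) (hy' : y' ∈ Q.motif) {j j' : ℕ}
    (h : y + (j : ℝ) • v = y' + (j' : ℝ) • v) : y = y' ∧ j = j' := by
  have hyy : y = y' := by
    refine Q.eq_of_sub_mem y hy y' hy' ((hv _).2 ⟨(j' : ℤ) - (j : ℤ), ?_⟩)
    rw [← Int.cast_smul_eq_zsmul ℝ, Int.cast_sub, Int.cast_natCast, Int.cast_natCast, sub_smul,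
      sub_eq_sub_iff_add_eq_add, h, add_comm]
  subst hyy
  refine ⟨rfl, ?_⟩
  have h2 : ((j : ℝ) - (j' : ℝ)) • v = 0 := by
    rw [sub_smul, sub_eq_zero]
    exact add_left_cancel h
  rcases smul_eq_zero.1 h2 with h3 | h3
  · exact Nat.cast_injective (sub_eq_zero.1 h3)
  · exact absurd h3 (ublock_v_ne_zero Q hv)

/-- DEEPNESS IN COORDINATES: for every radius `R` there is `D₀` (namely
`⌈(R + 2 Σ_{y ∈ F} ‖y‖) / ‖v‖⌉₊ + 1`) such that every point `z` of `Q` within distance `R` of a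
block point `y₀ + j • v` with `j ≥ D₀` is itself of the form `y' + m • v` with `y' ∈ F`,
`m ∈ ℕ`, `m < j + D₀` (write `z = y' + m v`, `m ∈ ℤ`; then
`|m - j| ‖v‖ ≤ R + ‖y'‖ + ‖y₀‖`). [folklore] -/
theorem ublock_near (Q : PeriodicConfiguration 1) {v : EuclideanSpace ℝ (Fin 1)}
    (hv : ∀ g : EuclideanSpace ℝ (Fin 1), g ∈ Q.lattice ↔ ∃ n : ℤ, g = n • v) (R : ℝ) :
    ∃ D₀ : ℕ, ∀ y₀ ∈ Q.motif, ∀ j : ℕ, D₀ ≤ j → ∀ z ∈ Q.points,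
      dist z (y₀ + (j : ℝ) • v) ≤ R →
        ∃ y' ∈ Q.motif, ∃ m : ℕ, m < j + D₀ ∧ z = y' + (m : ℝ) • v := by
  have hv0 : 0 < ‖v‖ := norm_pos_iff.2 (ublock_v_ne_zero Q hv)
  set B : ℝ := ∑ y ∈ Q.motif, ‖y‖ with hB
  have hBy : ∀ y ∈ Q.motif, ‖y‖ ≤ B := fun y hy =>
    Finset.single_le_sum (f := fun y => ‖y‖) (fun y _ => norm_nonneg y) hy
  refine ⟨⌈(R + 2 * B) / ‖v‖⌉₊ + 1, fun y₀ hy₀ j hj z hz hdist => ?_⟩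
  obtain ⟨y', hy', hzy'⟩ := Q.exists_sub_mem_lattice hz
  obtain ⟨m, hm⟩ := (hv _).1 hzy'
  have hz' : z = y' + (m : ℝ) • v := by
    rw [Int.cast_smul_eq_zsmul, ← hm]; abel
  -- the key estimate `|m - j| ‖v‖ ≤ R + 2B`
  have hkey : ((m : ℝ) - (j : ℝ)) • v = (z - (y₀ + (j : ℝ) • v)) - (y' - y₀) := by
    rw [hz', sub_smul]; abel
  have h1 : |(m : ℝ) - (j : ℝ)| * ‖v‖ ≤ R + 2 * B := by
    rw [← Real.norm_eq_abs, ← norm_smul, hkey]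
    calc ‖(z - (y₀ + (j : ℝ) • v)) - (y' - y₀)‖
        ≤ ‖z - (y₀ + (j : ℝ) • v)‖ + ‖y' - y₀‖ := norm_sub_le _ _
      _ ≤ R + (‖y'‖ + ‖y₀‖) := add_le_add (by rwa [← dist_eq_norm]) (norm_sub_le _ _)
      _ ≤ R + 2 * B := by linarith [hBy y' hy', hBy y₀ hy₀]
  have h2 : |(m : ℝ) - (j : ℝ)| ≤ (R + 2 * B) / ‖v‖ := by
    rwa [le_div_iff₀ hv0]
  have h3 : |(m : ℝ) - (j : ℝ)| < ((⌈(R + 2 * B) / ‖v‖⌉₊ + 1 : ℕ) : ℝ) := by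
    push_cast
    exact h2.trans_lt ((Nat.le_ceil _).trans_lt (lt_add_one _))
  have h4 : |m - (j : ℤ)| < ((⌈(R + 2 * B) / ‖v‖⌉₊ + 1 : ℕ) : ℤ) := by
    exact_mod_cast h3
  obtain ⟨h5, h6⟩ := abs_lt.1 h4
  have hm0 : 0 ≤ m := by omega
  have hmn : ((m.toNat : ℕ) : ℤ) = m := Int.toNat_of_nonneg hm0
  refine ⟨y', hy', m.toNat, by omega, ?_⟩
  rw [hz']
  congr 2
  exact_mod_cast hmn.symm

/-- COUNTING THROUGH `finProdFinEquiv`: if a predicate `P` on `Fin (n K)` holds at all indices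
with coordinates `(a₀, j)`, `D₀ ≤ j < K - D₀`, then `K - 2 D₀ ≤ Nat.card {i // P i}` (inject
`Fin (K - 2 D₀)`, `t ↦ finProdFinEquiv (a₀, t + D₀)`). [folklore] -/
theorem ublock_count {n K D₀ : ℕ} (a₀ : Fin n) (P : Fin (n * K) → Prop)
    (hP : ∀ j : ℕ, D₀ ≤ j → ∀ hj : j + D₀ < K,
      P (finProdFinEquiv (a₀, ⟨j, (Nat.le_add_right j D₀).trans_lt hj⟩))) :
    (K : ℝ) - ((2 * D₀ : ℕ) : ℝ) ≤ Nat.card {i // P i} := by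
  have hlt : ∀ t : Fin (K - 2 * D₀), (t : ℕ) + D₀ + D₀ < K := fun t => by omega
  let f : Fin (K - 2 * D₀) → {i // P i} := fun t =>
    ⟨finProdFinEquiv (a₀, ⟨(t : ℕ) + D₀, (Nat.le_add_right _ D₀).trans_lt (hlt t)⟩),
      hP ((t : ℕ) + D₀) (Nat.le_add_left D₀ t) (hlt t)⟩
  have hf : Function.Injective f := by
    intro t t' h
    have h1 : ((finProdFinEquiv.symm (f t).1).2 : ℕ) = ((finProdFinEquiv.symm (f t').1).2 : ℕ) := by
      rw [h]
    simp only [f, Equiv.symm_apply_apply] at h1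
    exact Fin.ext (by omega)
  have hcard := Nat.card_le_card_of_injective f hf
  rw [Nat.card_fin] at hcard
  have hKle : (K : ℝ) - ((2 * D₀ : ℕ) : ℝ) ≤ ((K - 2 * D₀ : ℕ) : ℝ) := by
    rw [sub_le_iff_le_add, ← Nat.cast_add, Nat.cast_le]
    exact le_tsub_add
  exact hKle.trans (by exact_mod_cast hcard)

/-- STUB W1a `stub_block1D` — BLOCKS OF A PERIODIC CONFIGURATION OF THE LINE: with
`Q.lattice = ℤv`, the block configuration `i ↦ y(i) + j(i)•v` on `Fin (#F·K)`
(`(y(i), j(i)) = (F.equivFin⁻¹ × id)(finProdFinEquiv⁻¹ i)`) is injective, lies in `Q.points`,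
and for every radius `R` there is a depth `D` (independent of `K`) such that for every site
`q₀ ∈ Q.points` at least `K − D` block points are congruent to `q₀` modulo the lattice AND
`R`-deep (every point of `Q` within `R` is a block point). [folklore] -/
theorem stub_block1D : ∀ (Q : PeriodicConfiguration 1) (v : EuclideanSpace ℝ (Fin 1)),
    (∀ g : EuclideanSpace ℝ (Fin 1), g ∈ Q.lattice ↔ ∃ n : ℤ, g = n • v) →
    (∀ K : ℕ, Function.Injective (fun i : Fin (Q.motif.card * K) => (((Q.motif.equivFin.symm (finProdFinEquiv.symm i).1 : Q.motif) : EuclideanSpace ℝ (Fin 1)) + (((finProdFinEquiv.symm i).2 : ℕ) : ℝ) • v))) ∧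
    (∀ (K : ℕ) (i : Fin (Q.motif.card * K)), (((Q.motif.equivFin.symm (finProdFinEquiv.symm i).1 : Q.motif) : EuclideanSpace ℝ (Fin 1)) + (((finProdFinEquiv.symm i).2 : ℕ) : ℝ) • v) ∈ Q.points) ∧
    (∀ R : ℝ, 0 < R → ∃ D : ℕ, ∀ (K : ℕ) (q₀ : EuclideanSpace ℝ (Fin 1)), q₀ ∈ Q.points →
      (K : ℝ) - D ≤ Nat.card {i : Fin (Q.motif.card * K) //
        (((Q.motif.equivFin.symm (finProdFinEquiv.symm i).1 : Q.motif) : EuclideanSpace ℝ (Fin 1)) + (((finProdFinEquiv.symm i).2 : ℕ) : ℝ) • v) - q₀ ∈ Q.lattice ∧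
        ∀ z ∈ Q.points, dist z ((((Q.motif.equivFin.symm (finProdFinEquiv.symm i).1 : Q.motif) : EuclideanSpace ℝ (Fin 1)) + (((finProdFinEquiv.symm i).2 : ℕ) : ℝ) • v)) ≤ R →
          ∃ j : Fin (Q.motif.card * K), (((Q.motif.equivFin.symm (finProdFinEquiv.symm j).1 : Q.motif) : EuclideanSpace ℝ (Fin 1)) + (((finProdFinEquiv.symm j).2 : ℕ) : ℝ) • v) = z}) := by
  intro Q v hv
  refine ⟨fun K => ?_, fun K i => ?_, fun R _ => ?_⟩
  · -- (1) injectivity, through the coordinates `(y(i), j(i))`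
    intro i i' h
    obtain ⟨h1, h2⟩ := ublock_coord_eq Q hv (Q.motif.equivFin.symm (finProdFinEquiv.symm i).1).2
      (Q.motif.equivFin.symm (finProdFinEquiv.symm i').1).2 h
    apply finProdFinEquiv.symm.injective
    exact Prod.ext (Q.motif.equivFin.symm.injective (Subtype.ext h1)) (Fin.ext h2)
  · -- (2) block points are points of `Q`
    exact Q.add_mem_points (Q.mem_points_of_mem_motif (Q.motif.equivFin.symm _).2)
      (ublock_natCast_smul_mem Q hv _)
  · -- (3) the deep count
    obtain ⟨D₀, hD₀⟩ := ublock_near Q hv R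
    refine ⟨2 * D₀, fun K q₀ hq₀ => ?_⟩
    obtain ⟨y₀, hy₀, hqy⟩ := Q.exists_sub_mem_lattice hq₀
    refine ublock_count (Q.motif.equivFin ⟨y₀, hy₀⟩) _ fun j hDj hjK => ?_
    simp only [Equiv.symm_apply_apply]
    refine ⟨?_, fun z hz hdist => ?_⟩
    · have e : y₀ + (j : ℝ) • v - q₀ = (j : ℝ) • v - (q₀ - y₀) := by abel
      rw [e]
      exact Q.lattice.sub_mem (ublock_natCast_smul_mem Q hv j) hqy
    · obtain ⟨y', hy', m, hm, rfl⟩ := hD₀ y₀ hy₀ j hDj z hz hdist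
      refine ⟨finProdFinEquiv (Q.motif.equivFin ⟨y', hy'⟩, ⟨m, by omega⟩), ?_⟩
      simp only [Equiv.symm_apply_apply]

end Summit.AtomisticToContinuum.Crystallization.Theorems.ThreeConeCertificateExactCertificate.Transfer1D

end
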